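import Literature.NumberTheory.LFunctions.ColossallyAbundantExponents
import HarnessLib

/-!
# RobinFiniteStairCA — g18 «THE WHOLE STAIRCASE», part 1/9

CA side: the storey test `σ(p^k)·log p ≤ P log P ⟹ a_p ≥ k` (`le_factorization_of_sigma_mul_log_le`), exponent `≤ 1` above `2√P+2`
(`factorization_le_one_of_ge`) and `Q < 4√P + 4` for the structure prime (`structureQ_lt`).

Cell rh-split, seat rh-split-robin-finite g18 (brief sha16 f79c5f09d8bcb036), card `cards/SPLIT-robin-finite.md` §25; carved VERBATIM from the
kernel-checked object `HOME/rh-split-robin-finite/g18/SketchG18.lean` (sha16 bca90f5376387c1c; `lean check` rc 0, 0 warnings, 0 sorries).  Zero `instance`,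
zero `notation`, no attribute changes, no `native_decide` in this file; no `def … : Prop`; every conjecture / print fact appears only as an explicit
hypothesis (`Buthe2016_thm2`, `Buthe2018_thm2_theta`, `BroadbentEtAl2021_theta_rel_1e19`, `RiemannHypothesisUpTo T`).

THE LINE.  A colossally abundant `N = ∏ p^{a_p}` with largest prime `P` and structure prime `Q` (largest prime of exponent `≥ 2`) satisfies not
only `log N ≥ θ(P) + θ(Q)` (the tree) but `log N ≥ θ(P) + θ(Q) + Λ` with `Λ = Σ_{j≥3} θ(x_j)` the higher storeys of the Alaoglu–Erdős staircase;
`Λ_K` is certified per dyadic piece `2^K ≤ P < 2^{K+1}` and spent on the analytic side as EXTRA zero-tail budget `d_k` on top of the tree's level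
budgets `b_k` (`E_b` is affine in `b`; the gain `G₁^Λ − G₁` pays `d_k·w(P)`), so the SAME verified height `T` certifies a LONGER range of CA primes.

HONEST LABEL: «SPLITTING SEARCH over kernel-typed RH-EQUIVALENCES; a splitting A ∧ B ⟹ RH is CONDITIONAL bookkeeping unless A and B
are both proved; nothing here bears on the truth of RH.»
-/

set_option linter.dupNamespace false

noncomputable section

open Real Finset
open scoped ArithmeticFunction.sigma Chebyshev

namespace Summit.RiemannHypothesis.RiemannHypothesis.Theorems.Splittings.RobinFiniteC1

section StaircaseCA

open Nat
variable {ε : ℝ} {N : ℕ}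

/-- **The storey test.**  If `N` admits the parameter `ε > 0`, `P` is a prime factor of `N` and
`σ(p^k)·log p ≤ P·log P` for a prime `p`, then `p^k ∣ N` (`k ≤ a_p`).
Proof: otherwise `a := a_p < k`; Prop. 3 upwards gives `p^{1+ε} ≥ σ(p^{a+1})/σ(p^a) = p + 1/σ(p^a) ≥ p + 1/σ(p^{k-1})`,
i.e. `p^ε ≥ 1 + 1/t` with `t = p·σ(p^{k-1}) = σ(p^k) − 1`; but `ε·log P ≤ log(1 + 1/P) ≤ 1/P`, so
`p^ε ≤ exp(log p/(P log P)) ≤ exp(1/(t+1)) < 1 + 1/t`. [cite: ErdosNicolas1975, Prop. 3, p. 69] -/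
theorem le_factorization_of_sigma_mul_log_le (h : IsCAParameter ε N) (hε : 0 < ε) (hN : N ≠ 0)
    {P p k : ℕ} (hP : P.Prime) (hPN : P ∣ N) (hp : p.Prime)
    (hk : (σ 1 (p ^ k) : ℝ) * Real.log p ≤ P * Real.log P) : k ≤ N.factorization p := by
  by_contra hlt
  push Not at hlt
  have hk1 : 1 ≤ k := by omega
  have hp0 : (0 : ℝ) < p := by exact_mod_cast hp.pos
  have hp1 : (1 : ℝ) < p := by exact_mod_cast hp.one_lt
  have hP1 : (1 : ℝ) < P := by exact_mod_cast hP.one_lt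
  have hP0 : (0 : ℝ) < P := by linarith
  have hlogp : 0 < Real.log p := Real.log_pos hp1
  have hlogP : 0 < Real.log P := Real.log_pos hP1
  -- `t = p σ(p^{k-1})`, `σ(p^k) = t + 1`
  set t : ℝ := (p : ℝ) * σ 1 (p ^ (k - 1)) with ht_def
  have hσk : (σ 1 (p ^ k) : ℝ) = t + 1 := by
    have e := sigma_one_prime_pow_succ hp (k - 1)
    rw [Nat.sub_add_cancel hk1] at e
    rw [e]; push_cast; rw [ht_def]
  have ht2 : (2 : ℝ) ≤ t := by
    have h1 : (1 : ℝ) ≤ σ 1 (p ^ (k - 1)) := by exact_mod_cast one_le_sigma_one_prime_pow hp (k - 1)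
    have h2 : (2 : ℝ) ≤ p := by exact_mod_cast hp.two_le
    rw [ht_def]; nlinarith
  have ht0 : 0 < t := by linarith
  -- upwards at `p`: `1 + 1/t ≤ p^ε`
  have hup : 1 + 1 / t ≤ (p : ℝ) ^ ε := by
    have h1 := h.sigma_div_le_rpow hN hp
    rw [sigma_prime_pow_succ_div hp, Real.rpow_add hp0, Real.rpow_one] at h1
    have hσa0 : (0 : ℝ) < σ 1 (p ^ N.factorization p) := by
      exact_mod_cast one_le_sigma_one_prime_pow hp _
    have h2 : (σ 1 (p ^ N.factorization p) : ℝ) ≤ σ 1 (p ^ (k - 1)) := by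
      exact_mod_cast sigma_one_le_of_dvd (pow_ne_zero _ hp.ne_zero) (pow_dvd_pow p (by omega))
    have h3 : 1 / t ≤ 1 / ((p : ℝ) * σ 1 (p ^ N.factorization p)) :=
      one_div_le_one_div_of_le (by positivity) (by rw [ht_def]; gcongr)
    have h4 : (p : ℝ) * (1 + 1 / ((p : ℝ) * σ 1 (p ^ N.factorization p))) ≤ p * (p : ℝ) ^ ε := by
      have e : (p : ℝ) * (1 + 1 / ((p : ℝ) * σ 1 (p ^ N.factorization p))) =
          p + 1 / σ 1 (p ^ N.factorization p) := by
        field_simp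
      rw [e]; exact h1
    have h5 := le_of_mul_le_mul_left h4 hp0
    linarith
  -- at the largest prime: `ε log P ≤ 1/P`
  have hεP : ε * Real.log P ≤ 1 / P := by
    have h1 := h.rpow_le_one_add_inv hN hP hPN
    have h2 : Real.log ((P : ℝ) ^ ε) ≤ Real.log (1 + (P : ℝ)⁻¹) :=
      Real.log_le_log (Real.rpow_pos_of_pos hP0 _) h1
    rw [Real.log_rpow hP0] at h2
    have h3 : Real.log (1 + (P : ℝ)⁻¹) ≤ (1 + (P : ℝ)⁻¹) - 1 := Real.log_le_sub_one_of_pos (by positivity)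
    rw [one_div]; linarith
  -- `p^ε ≤ exp(1/(t+1))`
  have hpe : (p : ℝ) ^ ε ≤ Real.exp (1 / (t + 1)) := by
    rw [Real.rpow_def_of_pos hp0]
    refine Real.exp_le_exp.2 ?_
    rw [le_div_iff₀ (by linarith)]
    calc Real.log p * ε * (t + 1) = ((σ 1 (p ^ k) : ℝ) * Real.log p) * ε := by rw [hσk]; ring
      _ ≤ (P * Real.log P) * ε := by gcongr
      _ = P * (ε * Real.log P) := by ring
      _ ≤ P * (1 / P) := by gcongr
      _ = 1 := by field_simp
  -- `exp(1/(t+1)) < 1 + 1/t`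
  have hexp : Real.exp (1 / (t + 1)) < 1 + 1 / t := by
    have hs : 0 < t + 1 := by linarith
    have h1 : -(1 / (t + 1)) + 1 < Real.exp (-(1 / (t + 1))) :=
      Real.add_one_lt_exp (by
        have : 0 < 1 / (t + 1) := by positivity
        linarith)
    have h2 : Real.exp (1 / (t + 1)) * Real.exp (-(1 / (t + 1))) = 1 := by
      rw [← Real.exp_add, add_neg_cancel, Real.exp_zero]
    have h3 : -(1 / (t + 1)) + 1 = t / (t + 1) := by field_simp; ring
    rw [h3] at h1
    have h4 : Real.exp (1 / (t + 1)) * (t / (t + 1)) < 1 := by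
      calc Real.exp (1 / (t + 1)) * (t / (t + 1)) < Real.exp (1 / (t + 1)) * Real.exp (-(1 / (t + 1))) :=
            mul_lt_mul_of_pos_left h1 (Real.exp_pos _)
        _ = 1 := h2
    have h5 : 1 + 1 / t = 1 / (t / (t + 1)) := by field_simp
    rw [h5, lt_div_iff₀ (by positivity)]
    exact h4
  linarith [hup, hpe, hexp]

/-- **Large primes have exponent `≤ 1`.**  If `N` admits `ε > 0`, its largest prime is `P`, and `p ≥ 2√P + 2` is prime,
then `a_p ≤ 1`: otherwise Prop. 3 downwards at `p` gives `p^ε ≤ 1 + 1/(p(p+1))`, i.e. `ε log p ≤ 1/(p(p+1))`, while a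
Bertrand prime `q ∈ (P, 2P]` (so `q ∤ N`) gives `ε ≥ 1/((q+1) log q) ≥ 1/((2P+1) log 2P)`; but
`p(p+1) log p > (2P+1) log(2P)`. [cite: AlaogluErdos1944, §3 (x₂ ≍ √x₁)] -/
theorem factorization_le_one_of_ge (h : IsCAParameter ε N) (hN : N ≠ 0) {P p : ℕ}
    (hP : P.Prime) (hmax : ∀ q ∈ N.primeFactors, q ≤ P) (hp : p.Prime)
    (hbig : 2 * √(P : ℝ) + 2 ≤ p) : N.factorization p ≤ 1 := by
  by_contra hlt
  push Not at hlt
  have hpN : p ∣ N := Nat.dvd_of_factorization_pos (by omega)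
  have hp0 : (0 : ℝ) < p := by exact_mod_cast hp.pos
  have hp1 : (1 : ℝ) < p := by exact_mod_cast hp.one_lt
  have hP0 : (0 : ℝ) < P := by exact_mod_cast hP.pos
  have hP2 : (2 : ℝ) ≤ P := by exact_mod_cast hP.two_le
  have hlogp : 0 < Real.log p := Real.log_pos hp1
  -- Bertrand prime above `P`, not dividing `N`
  obtain ⟨q, hq, hPq, hq2P⟩ := Nat.exists_prime_lt_and_le_two_mul P hP.ne_zero
  have hqN : ¬ q ∣ N := fun hqN =>
    absurd (hmax q (Nat.mem_primeFactors.2 ⟨hq, hqN, hN⟩)) (not_le.2 hPq)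
  have hεq := h.inv_le_eps hN hq hqN
  have hq1 : (1 : ℝ) < q := by exact_mod_cast hq.one_lt
  have hlogq : 0 < Real.log q := Real.log_pos hq1
  have hq2Pr : (q : ℝ) ≤ 2 * P := by exact_mod_cast hq2P
  -- downwards at `p`
  have hdown := h.rpow_le_one_add hN hp hpN
  have hσ : (p : ℝ) + 1 ≤ σ 1 (p ^ (N.factorization p - 1)) := by
    have h1 : σ 1 (p ^ 1) ≤ σ 1 (p ^ (N.factorization p - 1)) :=
      sigma_one_le_of_dvd (pow_ne_zero _ hp.ne_zero) (pow_dvd_pow p (by omega))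
    have h2 : σ 1 (p ^ 1) = p * σ 1 (p ^ 0) + 1 := sigma_one_prime_pow_succ hp 0
    rw [pow_zero, ArithmeticFunction.isMultiplicative_sigma.map_one, mul_one] at h2
    rw [h2] at h1
    exact_mod_cast h1
  have hpe : (p : ℝ) ^ ε ≤ 1 + 1 / ((p : ℝ) * (p + 1)) := by
    have : ((p : ℝ) * σ 1 (p ^ (N.factorization p - 1)))⁻¹ ≤ 1 / ((p : ℝ) * (p + 1)) := by
      rw [one_div]; exact inv_anti₀ (by positivity) (by gcongr)
    linarith
  have hlow : 1 + ε * Real.log p ≤ (p : ℝ) ^ ε := by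
    rw [Real.rpow_def_of_pos hp0]
    have := Real.add_one_le_exp (Real.log p * ε)
    linarith [mul_comm (Real.log p) ε]
  -- combine: `p (p+1) log p ≤ (q+1) log q ≤ (2P+1) log (2P)`
  have h1 : (p : ℝ) * (p + 1) * Real.log p ≤ ((q : ℝ) + 1) * Real.log q := by
    have e1 : ε * Real.log p ≤ 1 / ((p : ℝ) * (p + 1)) := by linarith
    have e2 : 1 / (((q : ℝ) + 1) * Real.log q) * Real.log p ≤ ε * Real.log p :=
      mul_le_mul_of_nonneg_right hεq hlogp.le
    have e3 := e2.trans e1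
    rw [div_mul_eq_mul_div, one_mul, div_le_div_iff₀ (by positivity) (by positivity), one_mul] at e3
    linarith
  have h2 : ((q : ℝ) + 1) * Real.log q ≤ (2 * P + 1) * Real.log (2 * P) := by
    have : Real.log q ≤ Real.log (2 * P) := Real.log_le_log (by linarith) hq2Pr
    gcongr
  have hsP := Real.sq_sqrt hP0.le
  have hsP0 := Real.sqrt_nonneg (P : ℝ)
  have h3 : 2 * (2 * (P : ℝ) + 1) ≤ (p : ℝ) * (p + 1) := by nlinarith
  have h4 : Real.log (2 * P) < 2 * Real.log p := by
    have hlt2 : (2 : ℝ) * P < (p : ℝ) ^ 2 := by nlinarith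
    have := Real.log_lt_log (by positivity) hlt2
    rwa [Real.log_pow, Nat.cast_ofNat] at this
  have hlog2P : 0 < Real.log (2 * P) := Real.log_pos (by linarith)
  have h5 : (2 * (P : ℝ) + 1) * Real.log (2 * P) < (p : ℝ) * (p + 1) * Real.log p := by
    calc (2 * (P : ℝ) + 1) * Real.log (2 * P) < (2 * P + 1) * (2 * Real.log p) := by gcongr
      _ = 2 * (2 * P + 1) * Real.log p := by ring
      _ ≤ (p : ℝ) * (p + 1) * Real.log p := by gcongr
  linarith

/-- **`Q < 4√P + 4`** for the structure prime of `exists_structure`: every prime `≤ Q` has exponent `≥ 2`, so a Bertrand prime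
in `(Q/2, Q]` has exponent `≥ 2` and is therefore `< 2√P + 2`. [cite: AlaogluErdos1944, §3] -/
theorem structureQ_lt (h : IsCAParameter ε N) (hN : N ≠ 0) {P Q : ℕ} (hP : P.Prime)
    (hpf : N.primeFactors = primesLE P) (h2 : ∀ p ∈ primesLE Q, 2 ≤ N.factorization p) :
    (Q : ℝ) < 4 * √(P : ℝ) + 4 := by
  have hmax : ∀ q ∈ N.primeFactors, q ≤ P := fun q hq => by
    rw [hpf] at hq; exact (Nat.mem_primesLE.1 hq).1
  have hs0 := Real.sqrt_nonneg (P : ℝ)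
  by_cases hQ : Q / 2 = 0
  · have : (Q : ℝ) ≤ 1 := by exact_mod_cast (show Q ≤ 1 by omega)
    linarith
  obtain ⟨p, hp, hlt, hle⟩ := Nat.exists_prime_lt_and_le_two_mul (Q / 2) hQ
  have hpQ : p ≤ Q := by omega
  have ha := h2 p (Nat.mem_primesLE.2 ⟨hpQ, hp⟩)
  have hsmall : (p : ℝ) < 2 * √(P : ℝ) + 2 := by
    by_contra hge
    push Not at hge
    have := factorization_le_one_of_ge h hN hP hmax hp hge
    omega
  have hQp : (Q : ℝ) < 2 * p := by exact_mod_cast (show Q < 2 * p by omega)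
  linarith

end StaircaseCA

end Summit.RiemannHypothesis.RiemannHypothesis.Theorems.Splittings.RobinFiniteC1

end
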